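import Mathlib
import Summits.Ventures.PercRepro2.SwOutMixedCore

/-!
# The m-piece raw cube: vocabulary (blind cell PercRepro2, night-4 g20, 2026-08-27;
proofs/NIGHT4-G20.md §1)

The big block of a mixed single junction whose h-piece has SEVERAL pieces `A i` (`i : μ`), each
joined to the single dropped vertex `p` by dead edges.  A point of the raw cube is
`(s, a, uP, e, f)`: `s` the u-arms (red = `true`), `a : μ → Bool` ONE COORDINATE PER PIECE,
`uP` the u–p edges, `e` the outside edges of `p` BLUE, `f` the far arms.  The red edge set is
`{U_j : s_j} ∪ {u : ∃ j, s_j} ∪ {A_i : a_i} ∪ {P : (∃ j, s_j) ∧ uP} ∪ {F_k : f_k}` (`ER`), the blue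
set is the red set of the flipped point (`EB`), and the leaking points are those with `p` in the
hull of `h` on one side while its outside edges or one of its pieces are on the other side
(`Leak`, the m-piece form of `BigBlock.Leak'`).  The non-leaking points are the CORE points
(`a_i = uP = e` for every `i`), the T-SLAB (`s = ⊤`, `uP = false`) and the B-SLAB (`s = ⊥`,
`uP = true`) — `not_leak_iff`.  `G5` is the X-move at a dropped `p`.  This file: the vocabulary,
the monotonicity of `ER`, the blindness of `ER` to `e`, and the generic transfer of the cube
principle (`card_le_of_embed`, the m-piece twin of `BigBlock.card_le_of_embed`).
-/

namespace Summit.Ventures.PercRepro2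

namespace MixedPieces

open scoped Classical

variable {ι μ κ : Type*}

/-- A point of the m-piece raw cube: `(s, a, uP, e, f)`. -/
abbrev PtM (ι μ κ : Type*) := Config ι × Config μ × Bool × Bool × Config κ

/-- The atoms: the u-arms, `u`, the pieces, `P`, the far arms. -/
abbrev AtomM (ι μ κ : Type*) := ι ⊕ (Unit ⊕ (μ ⊕ (Unit ⊕ κ)))

/-- The atom `u`. -/
def uA : AtomM ι μ κ := Sum.inr (Sum.inl ())

/-- The atom of the piece `i`. -/
def aA (i : μ) : AtomM ι μ κ := Sum.inr (Sum.inr (Sum.inl i))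

/-- The atom `P` (the dropped vertex). -/
def pA : AtomM ι μ κ := Sum.inr (Sum.inr (Sum.inr (Sum.inl ())))

/-- The atom of the far arm `k`. -/
def fA (k : κ) : AtomM ι μ κ := Sum.inr (Sum.inr (Sum.inr (Sum.inr k)))

section Defs

variable (p : PtM ι μ κ)

/-- The red edge set of a point (as a predicate on atoms). -/
def ER : Set (AtomM ι μ κ) := fun x =>
  match x with
  | Sum.inl j => p.1 j = true
  | Sum.inr (Sum.inl ()) => ∃ j, p.1 j = true
  | Sum.inr (Sum.inr (Sum.inl i)) => p.2.1 i = true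
  | Sum.inr (Sum.inr (Sum.inr (Sum.inl ()))) => (∃ j, p.1 j = true) ∧ p.2.2.1 = true
  | Sum.inr (Sum.inr (Sum.inr (Sum.inr k))) => p.2.2.2.2 k = true

/-- The total flip of a point. -/
def flipPt : PtM ι μ κ :=
  (flipAll p.1, flipAll p.2.1, !p.2.2.1, !p.2.2.2.1, flipAll p.2.2.2.2)

/-- The blue edge set: the red edge set of the flipped point. -/
def EB : Set (AtomM ι μ κ) := ER (flipPt p)

/-- The leaking points: `p` in the hull of `h` on one side (attached to a red `u` by red edges,
or to a blue `u` by blue edges) while its outside edges or one of its pieces are on the other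
side. -/
def Leak : Prop :=
  ((∃ j, p.1 j = true) ∧ p.2.2.1 = true ∧ p.2.2.2.1 = false) ∨
    ((∃ j, p.1 j = false) ∧ p.2.2.1 = false ∧ p.2.2.2.1 = true) ∨
    ((∃ j, p.1 j = true) ∧ p.2.2.1 = true ∧ ∃ i, p.2.1 i = false) ∨
    ((∃ j, p.1 j = false) ∧ p.2.2.1 = false ∧ ∃ i, p.2.1 i = true)

/-- The core points: every piece, the u–p edges and the outside edges of `p` carry one bit. -/
def Core : Prop := (∀ i, p.2.1 i = p.2.2.1) ∧ p.2.2.1 = p.2.2.2.1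

/-- The T-slab: all u-arms red, `p` dropped. -/
def TSlab : Prop := p.1 = (fun _ => true) ∧ p.2.2.1 = false

/-- The B-slab: all u-arms blue, `p` attached by red edges. -/
def BSlab : Prop := p.1 = (fun _ => false) ∧ p.2.2.1 = true

end Defs

/-- The property `G5` (the X-move at a dropped `p`): `(⊤, a, 0, e, f) ∈ Q` implies
`(⊥, a, 1, e, f) ∈ Q`. -/
def G5 (Q : Set (PtM ι μ κ)) : Prop :=
  ∀ (a : Config μ) (e : Bool) (f : Config κ), ((fun _ => true), a, false, e, f) ∈ Q →
    ((fun _ => false), a, true, e, f) ∈ Q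

section Basic

/-- A configuration is identically `false` iff every coordinate is. -/
lemma eq_const_false_iff (s : Config ι) : (∀ j, s j = false) ↔ s = fun _ => false := by
  constructor
  · intro h
    funext j
    exact h j
  · intro h j
    rw [h]

/-- A configuration is identically `true` iff every coordinate is. -/
lemma eq_const_true_iff (s : Config ι) : (∀ j, s j = true) ↔ s = fun _ => true := by
  constructor
  · intro h
    funext j
    exact h j
  · intro h j
    rw [h]

/-- Membership in the red edge set, atom by atom (definitional). -/
lemma mem_ER_inl (p : PtM ι μ κ) (j : ι) : (Sum.inl j : AtomM ι μ κ) ∈ ER p ↔ p.1 j = true :=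
  Iff.rfl

/-- Membership of `u` in the red edge set (definitional). -/
lemma mem_ER_u (p : PtM ι μ κ) :
    (Sum.inr (Sum.inl ()) : AtomM ι μ κ) ∈ ER p ↔ ∃ j, p.1 j = true := Iff.rfl

/-- Membership of the piece `i` in the red edge set (definitional). -/
lemma mem_ER_a (p : PtM ι μ κ) (i : μ) :
    (Sum.inr (Sum.inr (Sum.inl i)) : AtomM ι μ κ) ∈ ER p ↔ p.2.1 i = true := Iff.rfl

/-- Membership of `P` in the red edge set (definitional). -/
lemma mem_ER_p (p : PtM ι μ κ) :
    (Sum.inr (Sum.inr (Sum.inr (Sum.inl ()))) : AtomM ι μ κ) ∈ ER p ↔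
      (∃ j, p.1 j = true) ∧ p.2.2.1 = true := Iff.rfl

/-- Membership of the far arm `k` in the red edge set (definitional). -/
lemma mem_ER_f (p : PtM ι μ κ) (k : κ) :
    (Sum.inr (Sum.inr (Sum.inr (Sum.inr k))) : AtomM ι μ κ) ∈ ER p ↔ p.2.2.2.2 k = true :=
  Iff.rfl

/-- A configuration that is not identically `true` has a `false` coordinate. -/
lemma exists_eq_false_of_not_forall {s : Config ι} (hs : ¬ ∀ j, s j = true) : ∃ j, s j = false := by
  by_contra hc
  apply hs
  intro j
  by_contra hj
  exact hc ⟨j, by simpa using hj⟩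

/-- A configuration that is not identically `false` has a `true` coordinate. -/
lemma exists_eq_true_of_not_forall {s : Config ι} (hs : ¬ ∀ j, s j = false) : ∃ j, s j = true := by
  by_contra hc
  apply hs
  intro j
  by_contra hj
  exact hc ⟨j, by simpa using hj⟩

/-- A point is non-leaking iff it is a core point, a T-slab point or a B-slab point. -/
lemma not_leak_iff (p : PtM ι μ κ) : ¬ Leak p ↔ Core p ∨ TSlab p ∨ BSlab p := by
  obtain ⟨s, a, uP, e, f⟩ := p
  constructor
  · intro h
    simp only [Leak, not_or] at h
    obtain ⟨h1, h2, h3, h4⟩ := h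
    cases uP
    · by_cases hs : ∀ j, s j = true
      · exact Or.inr (Or.inl ⟨(eq_const_true_iff s).1 hs, rfl⟩)
      · have hj := exists_eq_false_of_not_forall hs
        cases e
        · refine Or.inl ⟨fun i => ?_, rfl⟩
          by_contra hi
          exact h4 ⟨hj, rfl, i, by simpa using hi⟩
        · exact absurd ⟨hj, rfl, rfl⟩ h2
    · by_cases hs : ∀ j, s j = false
      · exact Or.inr (Or.inr ⟨(eq_const_false_iff s).1 hs, rfl⟩)
      · have hj := exists_eq_true_of_not_forall hs
        cases e
        · exact absurd ⟨hj, rfl, rfl⟩ h1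
        · refine Or.inl ⟨fun i => ?_, rfl⟩
          by_contra hi
          exact h3 ⟨hj, rfl, i, by simpa using hi⟩
  · intro h hL
    simp only [Leak] at hL
    rcases h with ⟨ha, hu⟩ | ⟨hs, hu⟩ | ⟨hs, hu⟩
    · simp only at ha hu
      rcases hL with ⟨-, h2, h3⟩ | ⟨-, h2, h3⟩ | ⟨-, h2, i, hi⟩ | ⟨-, h2, i, hi⟩
      · rw [h2] at hu; rw [← hu] at h3; exact absurd h3 (by decide)
      · rw [h2] at hu; rw [← hu] at h3; exact absurd h3 (by decide)
      · rw [ha i, h2] at hi; exact absurd hi (by decide)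
      · rw [ha i, h2] at hi; exact absurd hi (by decide)
    · simp only at hs hu
      rcases hL with ⟨-, h2, -⟩ | ⟨⟨j, hj⟩, -, -⟩ | ⟨-, h2, -⟩ | ⟨⟨j, hj⟩, -, -⟩
      · rw [hu] at h2; exact absurd h2 (by decide)
      · rw [hs] at hj; exact absurd hj Bool.false_ne_true.symm
      · rw [hu] at h2; exact absurd h2 (by decide)
      · rw [hs] at hj; exact absurd hj Bool.false_ne_true.symm
    · simp only at hs hu
      rcases hL with ⟨⟨j, hj⟩, -, -⟩ | ⟨-, h2, -⟩ | ⟨⟨j, hj⟩, -, -⟩ | ⟨-, h2, -⟩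
      · rw [hs] at hj; exact absurd hj Bool.false_ne_true
      · rw [hu] at h2; exact absurd h2 (by decide)
      · rw [hs] at hj; exact absurd hj Bool.false_ne_true
      · rw [hu] at h2; exact absurd h2 (by decide)

/-- `true ≤ b` forces `b = true`. -/
lemma true_le_imp {b b' : Bool} (h : b ≤ b') (hb : b = true) : b' = true := by
  subst hb
  cases b'
  · exact absurd h (by decide)
  · rfl

/-- The red edge set is monotone. -/
lemma ER_mono {p q : PtM ι μ κ} (h : p ≤ q) : ER p ⊆ ER q := by
  obtain ⟨hs, ha, hu, -, hf⟩ := h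
  intro x hx
  rcases x with j | ⟨⟨⟩⟩ | i | ⟨⟨⟩⟩ | k
  · exact true_le_imp (hs j) hx
  · obtain ⟨j, hj⟩ := hx
    exact ⟨j, true_le_imp (hs j) hj⟩
  · exact true_le_imp (ha i) hx
  · obtain ⟨⟨j, hj⟩, hp⟩ := hx
    exact ⟨⟨j, true_le_imp (hs j) hj⟩, true_le_imp hu hp⟩
  · exact true_le_imp (hf k) hx

/-- The red edge set does not see the coordinate `e`. -/
lemma ER_eq_of_eq {p q : PtM ι μ κ} (hs : p.1 = q.1) (ha : p.2.1 = q.2.1)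
    (hu : p.2.2.1 = q.2.2.1) (hf : p.2.2.2.2 = q.2.2.2.2) : ER p = ER q := by
  ext x
  rcases x with j | ⟨⟨⟩⟩ | i | ⟨⟨⟩⟩ | k
  · rw [mem_ER_inl, mem_ER_inl, hs]
  · rw [mem_ER_u, mem_ER_u, hs]
  · rw [mem_ER_a, mem_ER_a, ha]
  · rw [mem_ER_p, mem_ER_p, hs, hu]
  · rw [mem_ER_f, mem_ER_f, hf]

/-- The total flip is an involution. -/
lemma flipPt_flipPt (p : PtM ι μ κ) : flipPt (flipPt p) = p := by
  obtain ⟨s, a, uP, e, f⟩ := p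
  simp only [flipPt, flipAll_involutive s, flipAll_involutive a, flipAll_involutive f,
    Bool.not_not]

end Basic

section Transfer

variable {P α : Type*}

/-- **The cube principle, transferred** (generic form): a finite set `S` of points carried
injectively by `ψ` onto a lower set of a cube `Config E'`, on which the red set is a monotone
function `ER'` of the cube point and the blue set is `ER'` of the flipped cube point, satisfies
the rigid counting inequality for every up-set `𝓔` (`LocRows.card_inter_le_of_cube`). -/
theorem card_le_of_embed (ER EB : P → Set α) {E' : Type*} [Fintype E'] [DecidableEq E']
    (S : Finset P) (ψ : P → Config E') (hinj : Set.InjOn ψ S)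
    (ER' : Config E' → Set α) (hmono : Monotone ER')
    (hR : ∀ p ∈ S, ER p = ER' (ψ p)) (hB : ∀ p ∈ S, EB p = ER' (flipAll (ψ p)))
    (hL : IsLowerSet (ψ '' (S : Set P)))
    {𝓔 : Set (Set α)} (h𝓔 : IsUpperSet 𝓔) :
    (S.filter fun p => ER p ∈ 𝓔).card ≤ (S.filter fun p => EB p ∈ 𝓔).card := by
  have e1 : (S.filter fun p => ER p ∈ 𝓔).card =
      (Finset.univ.filter fun x : Config E' => x ∈ ψ '' (S : Set P) ∧ ER' x ∈ 𝓔).card := by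
    rw [← Finset.card_image_of_injOn (hinj.mono (by
      intro x hx
      simp only [Finset.coe_filter, Set.mem_setOf_eq] at hx
      exact hx.1))]
    congr 1
    ext x
    simp only [Finset.mem_image, Finset.mem_filter, Finset.mem_univ, true_and, Set.mem_image,
      Finset.mem_coe]
    constructor
    · rintro ⟨p, ⟨hp, hE⟩, rfl⟩
      exact ⟨⟨p, hp, rfl⟩, by rw [← hR p hp]; exact hE⟩
    · rintro ⟨⟨p, hp, rfl⟩, hE⟩
      exact ⟨p, ⟨hp, by rw [hR p hp]; exact hE⟩, rfl⟩
  have e2 : (S.filter fun p => EB p ∈ 𝓔).card =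
      (Finset.univ.filter fun x : Config E' =>
        x ∈ ψ '' (S : Set P) ∧ ER' (flipAll x) ∈ 𝓔).card := by
    rw [← Finset.card_image_of_injOn (hinj.mono (by
      intro x hx
      simp only [Finset.coe_filter, Set.mem_setOf_eq] at hx
      exact hx.1))]
    congr 1
    ext x
    simp only [Finset.mem_image, Finset.mem_filter, Finset.mem_univ, true_and, Set.mem_image,
      Finset.mem_coe]
    constructor
    · rintro ⟨p, ⟨hp, hE⟩, rfl⟩
      exact ⟨⟨p, hp, rfl⟩, by rw [← hB p hp]; exact hE⟩
    · rintro ⟨⟨p, hp, rfl⟩, hE⟩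
      exact ⟨p, ⟨hp, by rw [hB p hp]; exact hE⟩, rfl⟩
  have hA : IsUpperSet {x : Config E' | ER' x ∈ 𝓔} := by
    intro x y hle hx
    exact h𝓔 (hmono hle) hx
  have hB' : IsLowerSet {x : Config E' | ER' (flipAll x) ∈ 𝓔} := by
    intro x y hle hx
    exact h𝓔 (hmono (MixedCube.flipAll_le_flipAll' hle)) hx
  have hAB : flipAll ⁻¹' {x : Config E' | ER' (flipAll x) ∈ 𝓔} = {x : Config E' | ER' x ∈ 𝓔} := by
    ext x
    simp only [Set.mem_preimage, Set.mem_setOf_eq, flipAll_involutive x]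
  have key := LocRows.card_inter_le_of_cube hL hA hB' hAB
  rw [e1, e2]
  convert key using 2 <;> apply Finset.filter_congr <;> intro x _ <;>
    simp only [Set.mem_inter_iff, Set.mem_setOf_eq]

end Transfer

end MixedPieces

end Summit.Ventures.PercRepro2
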